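import Literature.NumberTheory.CubicFields.UniformityEstimateOfDictionary
import Literature.NumberTheory.CubicFields.HasseDictionaryProofs
import HarnessLib

/-!
# BTT 2023, Proposition 4.5 (the case `q² ∣ D`): discharge of `btt_uniformity_sqDvd`

`Proofs` file (theorems only), topic `Literature/NumberTheory/CubicFields`.  The named fact
`Literature.NumberTheory.CubicFields.btt_uniformity_sqDvd` (`UniformityEstimate.lean`;
Bhargava–Taniguchi–Thorne, Math. Ann. 389 (2024), Prop. 4.5: for squarefree `q` the number of cubic
rings `R` with `q² ∣ Disc(R)` and `0 < ±Disc(R) < X` is `O(6^{ω(q)} X/q²)`) is now a THEOREM of the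
tree: `btt_uniformity_sqDvd_of_dictionary` (`UniformityEstimateOfDictionary.lean`: the reduction to
maximal rings and to fields, the class-field-theoretic per-discriminant bound, Davenport's `O(X)`
bounds for binary cubic forms of both signs, Belabas–Bhargava–Pomerance Lemmas 2.2, 3.3, 3.4) fed with
the PROVED Hasse dictionary `#Cl(ℚ(√D))[3] = 2 · #{cubic fields of discriminant D} + 1`
(`threeTorsion_eq_two_mul_cubicFieldCountOfDisc_add_one_holds`, `HasseDictionaryProofs.lean`).
This file only assembles the two (it cannot live in `UniformityEstimate.lean` itself, which is
upstream of both inputs).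

## References

* M. Bhargava, T. Taniguchi, F. Thorne, *Improved error estimates for the Davenport–Heilbronn theorems*,
  Math. Ann. 389 (2024) = arXiv:2107.12819, §4.2, Prop. 4.5 [BhargavaTaniguchiThorne2023].
* K. Belabas, M. Bhargava, C. Pomerance, *Error estimates for the Davenport–Heilbronn theorems*, Duke
  Math. J. 153 (2010), Lemmas 2.2, 3.3, 3.4 [BelabasBhargavaPomerance2010].
* H. Davenport, H. Heilbronn, *On the density of discriminants of cubic fields. II*, Proc. Roy. Soc.
  London A 322 (1971) 405–420, §6 [DavenportHeilbronn1971].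
-/

noncomputable section

namespace Literature.NumberTheory.CubicFields

/-- **Bhargava–Taniguchi–Thorne 2023, Proposition 4.5 (`q² ∣ D`), proved**: there is an absolute `C`
with `Σ_{0 < s·D < X, q² ∣ D} h(D) ≤ C · 6^{ω(q)} X / q²` for every squarefree `q`, both signs `s = ±1`
and every `X` — the discharge of the named fact `btt_uniformity_sqDvd`.
[cite: BhargavaTaniguchiThorne2023, Proposition 4.5] -/
theorem btt_uniformity_sqDvd_holds : btt_uniformity_sqDvd :=
  btt_uniformity_sqDvd_of_dictionary threeTorsion_eq_two_mul_cubicFieldCountOfDisc_add_one_holds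

end Literature.NumberTheory.CubicFields

end
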